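import Summits.AnomalousDissipation.AnomalousDissipation.Theorems.BaireTransferDenseLoudDesignerForcesErgodicHyperbolicityKey
import Summits.AnomalousDissipation.AnomalousDissipation.Theorems.BaireTransferDenseLoudDesignerForcesErgodicModelCoreDynamics
import Summits.AnomalousDissipation.AnomalousDissipation.Theorems.BaireTransferDenseLoudDesignerForcesErgodicLinearisedVDataExistence
import Summits.AnomalousDissipation.AnomalousDissipation.Theorems.BaireTransferDenseLoudDesignerForcesErgodicPhaseGevrey
import Summits.AnomalousDissipation.AnomalousDissipation.Theorems.BaireTransferDenseLoudDesignerForcesErgodicGevreySobolevBounds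
import Summits.AnomalousDissipation.AnomalousDissipation.Theorems.BaireTransferDenseLoudDesignerForcesErgodicFrameCurveDeriv
import Summits.AnomalousDissipation.AnomalousDissipation.Theorems.BaireTransferDenseLoudDesignerForcesErgodicTimeDerivLinearised
import Literature.Analysis.FunctionSpaces.TorusLinearisedNSGlobalExistence
import Literature.Dynamics.Hyperbolic.HyperbolicSemiflowModel

/-!
# The derivative cocycle of the model map at a core point is the frame of the linearised Navier–Stokes flow
# (block N-A, helper for the tools stub A3 `stub_hyperbolicityTransferTools`, line `ergodic-budget-selection-closing`,
# crux `BaireTransfer.DenseLoudDesignerForces`, stmt-AnomalousDissipation-1143)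

Summit-side glue (sorry-free, no definitions) over the KEY lemmas of `…ErgodicHyperbolicityKey.lean`:

* `exists_trajectory_of_mem_frameCore` — the objects at a point `y` of the frame core `F.S ⁻¹' Kc` of an NS phase with a
  compact invariant core `Kc`: the classical trajectory `(u, p)` of the state `F.S y` (`IsNSPhase.trajectory`), the
  conjugacy `F.S (g t y) = [u t]` of any family `g` conjugate to the phase on the core, the semigroup law of `g` along the
  orbit, and UNIFORM Gevrey (`stub_phaseGevreyTools` on the invariant core) and sup bounds (`stub_gevreySobolevBoundsTools`)
  of the trajectory;
* `exists_linearised_of_derivCocycle` — THE COCYCLE IDENTIFICATION: for every datum `h'` there is a classical solution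
  `(W, Q)` of the linearised equation along `u` on `[1, ∞)` with `Tⁿ_y h' = F.S ([W n] − [Δ W n])` for all `n ≥ 1`
  (L2 `stub_linearisedVDataExistenceTools` from the `V`-datum `F.S h'` on `(0, 3]`, the rough KEY lemma at `y`, the global
  continuation `Torus.linearisedNS_exists_Ici` from time `1` patched by forward uniqueness, and the closed KEY lemma at
  the core points `g n y` along `u(n + ·)` for the induction);
* `flowDir_modelMap_eq` — the flow direction of the model at `y` is the frame of `∂ₜu(0)` (A3a `stub_frameCurveDerivTools`),
  and `fderiv_modelMap_one_flowDir` — its image under `D(g 1)(y)` is the frame of `∂ₜu(1)` (A1 + closed KEY lemma).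

References: Z. Lian, L.-S. Young, JAMS 25 (2012) §1; D. Henry, LNM 840 (1981) Cor. 3.4.6; P. Constantin, C. Foias,
*Navier–Stokes Equations* (1988) Ch. 13–14.  Nothing is asserted; no definition is added.
-/

-- `Summit.<Summit>.<Problem>` is the tree's mandated summit-side namespace (CONVENTIONS §2); for this
-- single-conjunct summit the two coincide, so the duplicate is deliberate.
set_option linter.dupNamespace false

noncomputable section

open Set Function MeasureTheory Filter
open scoped InnerProductSpace Topology ENNReal

namespace Summit.AnomalousDissipation.AnomalousDissipation.Theorems.DenseLoudDesignerForces.Ergodic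

open Literature.Analysis.FunctionSpaces Literature.Analysis.FunctionSpaces.Torus
open Literature.Analysis.FluidPDE Literature.Analysis.FluidPDE.Torus
open Summit.AnomalousDissipation.AnomalousDissipation.Theorems.DenseLoudDesignerForces.Negative
open Literature.Dynamics.Hyperbolic

/-! ## Objects at a point of the frame core -/

/-- **The objects at a point of the frame core.**  Let `(K, φ)` be an NS phase of the designer force at `ν > 0`, `Kc ⊆ K` with
`φ_t(Kc) = Kc`, `g` a family conjugate to the phase on the frame core (`F.S (g t y) = φ_t (F.S y)` for `F.S y ∈ Kc`), and
`F.S y ∈ Kc`.  Then the classical trajectory `(u, p)` of `F.S y` satisfies: `rep (φ_t (F.S y)) = u t` a.e., `u t` has zero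
mean, `F.S (g t y) = [u t] ∈ Kc`, `g s (g t y) = g (s + t) y`, `g 0 y = y` (`F.S` injective), a UNIFORM Gevrey bound of all
slices `u t`, `t ≥ 0` (`stub_phaseGevreyTools`: every core state is `φ_1` of a core state), and uniform sup bounds of `u`
and `∂ᵢu` (`stub_gevreySobolevBoundsTools`). [folklore] -/
theorem exists_trajectory_of_mem_frameCore {S : Finset (Fin 3 → ℤ)} {c : ↥S → (EuclideanSpace ℂ (Fin 3))} {ν : ℝ}
    {K : Set Hsp} {φ : ℝ → Hsp → Hsp} (hν : 0 < ν) (hK : IsNSPhase ν (force S c) K φ) (F : ModelFrame) {Kc : Set Hsp}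
    (hKcK : Kc ⊆ K) (hinv : ∀ t : ℝ, 0 ≤ t → φ t '' Kc = Kc) {g : ℝ → Hsp → Hsp}
    (hconj : ∀ t : ℝ, 0 ≤ t → ∀ y : Hsp, F.S y ∈ Kc → F.S (g t y) = φ t (F.S y)) {y : Hsp} (hy : F.S y ∈ Kc) :
    ∃ (u : ℝ → (UnitAddTorus (Fin 3)) → (EuclideanSpace ℝ (Fin 3))) (p : ℝ → (UnitAddTorus (Fin 3)) → ℝ),
      IsClassicalNSSolutionOn (Ici 0) ν (fun _ => force S c) u p ∧
      (∀ t : ℝ, 0 ≤ t → rep (φ t (F.S y)) =ᵐ[volume] u t) ∧ (∀ t : ℝ, 0 ≤ t → HasZeroMean (u t)) ∧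
      (∀ t : ℝ, 0 ≤ t → F.S (g t y) = stateOf (u t)) ∧ (∀ t : ℝ, 0 ≤ t → F.S (g t y) ∈ Kc) ∧
      (∀ s t : ℝ, 0 ≤ s → 0 ≤ t → g s (g t y) = g (s + t) y) ∧ g 0 y = y ∧
      (∃ σ₀ C₀ : ℝ, 0 < σ₀ ∧ ∀ t : ℝ, 0 ≤ t → ∀ S' : Finset (Fin 3 → ℤ),
        ∑ k ∈ S', Real.exp (2 * σ₀ * Real.sqrt (freqNormSq k)) *
          ‖UnitAddTorus.mFourierCoeff (EuclideanSpace.complexify ∘ u t) k‖ ^ 2 ≤ C₀) ∧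
      ∃ B : ℝ, (∀ t ∈ Ici (0 : ℝ), ∀ x, ‖u t x‖ ≤ B) ∧ ∀ i, ∀ t ∈ Ici (0 : ℝ), ∀ x, ‖partialDeriv i (u t) x‖ ≤ B := by
  have hx : F.S y ∈ K := hKcK hy
  obtain ⟨u, p, hsol, hrep⟩ := hK.trajectory (F.S y) hx
  have hus : ∀ t : ℝ, 0 ≤ t → IsSmooth (u t) := fun t ht => hsol.smooth_velocity.isSmooth_slice (mem_Ici.2 ht)
  have hud : ∀ t : ℝ, 0 ≤ t → IsDivFree (u t) := fun t ht => hsol.divFree t (mem_Ici.2 ht)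
  have hum : ∀ t : ℝ, 0 ≤ t → HasZeroMean (u t) := fun t ht => hasZeroMean_of_rep_ae_eq (φ t (F.S y)) (hrep t ht)
  have hst : ∀ t : ℝ, 0 ≤ t → stateOf (u t) = φ t (F.S y) := fun t ht =>
    (eq_stateOf_of_rep_ae_eq _ (hus t ht) (hud t ht) (hrep t ht)).symm
  have horb : ∀ t : ℝ, 0 ≤ t → F.S (g t y) = stateOf (u t) := fun t ht => by rw [hconj t ht y hy, hst t ht]
  have hmaps : ∀ t : ℝ, 0 ≤ t → F.S (g t y) ∈ Kc := fun t ht => by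
    rw [hconj t ht y hy, ← hinv t ht]
    exact mem_image_of_mem _ hy
  have hsemi : ∀ s t : ℝ, 0 ≤ s → 0 ≤ t → g s (g t y) = g (s + t) y := fun s t hs ht =>
    F.hSinj (by rw [hconj s hs _ (hmaps t ht), hconj t ht y hy, hconj (s + t) (add_nonneg hs ht) y hy,
      hK.map_add s t hs ht _ hx])
  have hg0 : g 0 y = y := F.hSinj (by rw [hconj 0 le_rfl y hy, hK.map_zero _ hx])
  -- uniform Gevrey bound on the invariant core
  obtain ⟨σ, hσ, C, hC⟩ := stub_phaseGevreyTools hν hK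
  have hGev : ∀ t : ℝ, 0 ≤ t → ∀ S' : Finset (Fin 3 → ℤ),
      ∑ k ∈ S', Real.exp (2 * σ * Real.sqrt (freqNormSq k)) *
        ‖UnitAddTorus.mFourierCoeff (EuclideanSpace.complexify ∘ u t) k‖ ^ 2 ≤ C := by
    intro t ht S'
    have hmem : φ t (F.S y) ∈ φ 1 '' Kc := by
      rw [hinv 1 zero_le_one, ← hinv t ht]
      exact mem_image_of_mem _ hy
    obtain ⟨x', hx', hx'eq⟩ := hmem
    have hae : (EuclideanSpace.complexify ∘ rep (φ 1 x')) =ᵐ[volume] (EuclideanSpace.complexify ∘ u t) := by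
      rw [hx'eq]
      exact (hrep t ht).fun_comp _
    calc ∑ k ∈ S', Real.exp (2 * σ * Real.sqrt (freqNormSq k)) *
          ‖UnitAddTorus.mFourierCoeff (EuclideanSpace.complexify ∘ u t) k‖ ^ 2
        = ∑ k ∈ S', Real.exp (2 * σ * Real.sqrt (freqNormSq k)) *
          ‖UnitAddTorus.mFourierCoeff (EuclideanSpace.complexify ∘ rep (φ 1 x')) k‖ ^ 2 :=
          Finset.sum_congr rfl fun k _ => by rw [mFourierCoeff_congr_ae hae k]
      _ ≤ C := hC x' (hKcK hx') 1 le_rfl S'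
  obtain ⟨B, hB⟩ := stub_gevreySobolevBoundsTools (C := C) hσ
  exact ⟨u, p, hsol, hrep, hum, horb, hmaps, hsemi, hg0, ⟨σ, C, hσ, hGev⟩, B,
    fun t ht x => (hB (u t) (hus t ht) (hGev t ht)).1 x, fun i t ht x => (hB (u t) (hus t ht) (hGev t ht)).2.1 i x⟩

/-! ## The cocycle identification -/

section Cocycle

variable (F : ModelFrame) {ν : ℝ} (hν : 0 < ν) (xF : Hsp) {U U' : Set Hsp} (hU : IsOpen U) (hU' : IsOpen U') (hUU' : U ⊆ U')
  (htube : ∀ y ∈ U, ∀ t ∈ Icc (0 : ℝ) 3, ∃ (ht : 0 ≤ t) (z : C(Icc (0 : ℝ) t, Hsp)),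
    F.IsMild ν xF ht y z ∧ (∀ r, z r ∈ U') ∧ F.modelMap ν xF U' t y = z ⟨t, ht, le_rfl⟩)
  (hcont : ContinuousOn (fun q : ℝ × Hsp => F.modelMap ν xF U' q.1 q.2) (Icc (0 : ℝ) 3 ×ˢ U))

include hν hU hU' hUU' htube hcont

/-- **THE COCYCLE IDENTIFICATION.**  In the setting of the model map `g = F.modelMap ν xF U'` on `U` (tube, joint
continuity), let `y` have its whole model orbit in `U`, conjugate to the classical field `u` (`F.S (g t y) = [u t]`,
`g s (g t y) = g (s + t) y`, `g 0 y = y`), where `u` is a classical NS trajectory on `[0, ∞)` with mean-zero slices and a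
uniform Gevrey bound.  Then for every datum `h'` there is a classical solution `(W, Q)` of the linearised equation along `u`
on `[1, ∞)` with `derivCocycle g y n h' = F.S ([W n] − [Δ W n])` for all `n ≥ 1`.  Proof: the linearised solution `w₀`
from the `V`-datum `F.S h'` on `(0, 3]` (L2) gives `D(g t)(y) h' = F.S([w₀ t] − [Δ w₀ t])` there (rough KEY lemma);
continue `w₀ 1` globally (`Torus.linearisedNS_exists_Ici`, `= w₀` on `[1, 3]` by forward uniqueness); the step
`n → n + 1` is the closed KEY lemma at the core point `g n y` along `u` on `[n, n + 3]`. [folklore] -/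
theorem exists_linearised_of_derivCocycle {y : Hsp} (hyU : ∀ t : ℝ, 0 ≤ t → F.modelMap ν xF U' t y ∈ U)
    {f : (UnitAddTorus (Fin 3)) → (EuclideanSpace ℝ (Fin 3))}
    {u : ℝ → (UnitAddTorus (Fin 3)) → (EuclideanSpace ℝ (Fin 3))} {p : ℝ → (UnitAddTorus (Fin 3)) → ℝ}
    (hsol : IsClassicalNSSolutionOn (Ici 0) ν (fun _ => f) u p) (hum : ∀ t : ℝ, 0 ≤ t → HasZeroMean (u t))
    (horb : ∀ t : ℝ, 0 ≤ t → F.S (F.modelMap ν xF U' t y) = stateOf (u t))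
    (hsemi : ∀ s t : ℝ, 0 ≤ s → 0 ≤ t → F.modelMap ν xF U' s (F.modelMap ν xF U' t y) = F.modelMap ν xF U' (s + t) y)
    (hg0 : F.modelMap ν xF U' 0 y = y) {σ₀ C₀ : ℝ} (hσ₀ : 0 < σ₀)
    (hGev : ∀ t : ℝ, 0 ≤ t → ∀ S' : Finset (Fin 3 → ℤ), ∑ k ∈ S', Real.exp (2 * σ₀ * Real.sqrt (freqNormSq k)) *
      ‖UnitAddTorus.mFourierCoeff (EuclideanSpace.complexify ∘ u t) k‖ ^ 2 ≤ C₀) (h' : Hsp) :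
    ∃ (W : ℝ → (UnitAddTorus (Fin 3)) → (EuclideanSpace ℝ (Fin 3))) (Q : ℝ → (UnitAddTorus (Fin 3)) → ℝ),
      IsLinearizedNSSolutionOn (Ici 1) ν u W Q ∧
      ∀ n : ℕ, 1 ≤ n → derivCocycle (F.modelMap ν xF U') y n h' = F.S (stateOf (W n) - stateOf (laplacian (W n))) := by
  have hus : ∀ t : ℝ, 0 ≤ t → IsSmooth (u t) := fun t ht => hsol.smooth_velocity.isSmooth_slice (mem_Ici.2 ht)
  have hud : ∀ t : ℝ, 0 ≤ t → IsDivFree (u t) := fun t ht => hsol.divFree t (mem_Ici.2 ht)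
  have hy0 : y ∈ U := by simpa only [hg0] using hyU 0 le_rfl
  -- (i) the linearised solution from the `V`-datum `F.S h'` on `(0, 3]` (L2)
  have hsub03 : Icc (0 : ℝ) (0 + 3) ⊆ Ici 0 := fun t ht => ht.1
  obtain ⟨CL, hL2⟩ := stub_linearisedVDataExistenceTools hν (a := 0) (L := 3) zero_lt_three
    (hsol.smooth_velocity.mono hsub03) (fun t ht => hud t ht.1) (fun t ht => hum t ht.1) hσ₀ (fun t ht S' => hGev t ht.1 S')
  obtain ⟨w₀, q₀, hlin₀, -, hL, hH⟩ := hL2 (F.S h') (F.frame_norm_sq_le h').1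
  have e3 : (0 : ℝ) + 3 = 3 := zero_add 3
  rw [e3] at hlin₀
  -- (ii) the rough KEY lemma at `y`
  have hsubI3 : Icc (0 : ℝ) 3 ⊆ Ici 0 := fun t ht => ht.1
  have hD₀ := F.fderiv_modelMap_eq_frame_of_tendsto hν xF hU hU' hUU' htube hcont hy0 (hsol.smooth_velocity.mono hsubI3)
    (fun t ht => hud t ht.1) (fun t ht => hum t ht.1) hlin₀ (fun s hs => horb s hs.1) h' hL hH
  -- (iii) the global continuation from time `1`
  have h1 : (1 : ℝ) ∈ Ioc (0 : ℝ) 3 := ⟨zero_lt_one, by norm_num⟩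
  have hsubI1 : Ici (1 : ℝ) ⊆ Ici 0 := Ici_subset_Ici.2 zero_le_one
  obtain ⟨W, Q, hWs, hQs, hWd, hWm, -, hWeq, hW1⟩ := linearisedNS_exists_Ici hν (hsol.smooth_velocity.mono hsubI1)
    (fun t ht => hud t (zero_le_one.trans ht)) (hlin₀.1.isSmooth_slice h1) (hlin₀.2.2.1 1 h1) (hlin₀.2.2.2.1 1 h1)
  have hlinW : IsLinearizedNSSolutionOn (Ici 1) ν u W Q := ⟨hWs, hQs, hWd, hWm, hWeq⟩
  -- (iv) `W = w₀` on `[1, 3]` (forward uniqueness)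
  have hagree : ∀ t ∈ Icc (1 : ℝ) 3, W t = w₀ t := by
    intro t ht
    have hsubA : Icc (1 : ℝ) 3 ⊆ Ici 1 := fun s hs => hs.1
    have hsubB : Icc (1 : ℝ) 3 ⊆ Ioc 0 3 := fun s hs => ⟨by linarith [hs.1], hs.2⟩
    have hWr := hlinW.mono hsubA (uniqueDiffOn_Icc (by norm_num))
    have hwr := hlin₀.mono hsubB (uniqueDiffOn_Icc (by norm_num))
    exact linearisedNS_eq_of_eq hν (convex_Icc 1 3) (hsol.smooth_velocity.mono (hsubA.trans hsubI1))
      (fun s hs => hud s (by linarith [hs.1])) hWr.1 hWr.2.1 hWr.2.2.1 hWr.2.2.2.2 hwr.1 hwr.2.1 hwr.2.2.1 hwr.2.2.2.2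
      (left_mem_Icc.2 (by norm_num)) hW1 ht
  -- (v) induction over the cocycle
  refine ⟨W, Q, hlinW, fun n hn => ?_⟩
  induction n with
  | zero => exact absurd hn (by norm_num)
  | succ n ih =>
    rw [derivCocycle_succ, ContinuousLinearMap.comp_apply]
    rcases Nat.eq_zero_or_pos n with hn0 | hnpos
    · -- the first step: the rough KEY lemma at time `1`
      subst hn0
      have e : F.modelMap ν xF U' ((0 : ℕ) : ℝ) y = y := by rw [Nat.cast_zero, hg0]
      rw [derivCocycle_zero, e, one_apply_eq_self]
      have key : fderiv ℝ (F.modelMap ν xF U' 1) y h' = F.S (stateOf (w₀ 1) - stateOf (laplacian (w₀ 1))) := hD₀ 1 h1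
      rw [key, Nat.cast_succ, Nat.cast_zero, zero_add, hagree 1 ⟨le_rfl, by norm_num⟩]
    · -- the step `n → n + 1`, `n ≥ 1`: the closed KEY lemma at the core point `g n y` along `u` on `[n, n + 3]`
      rw [ih hnpos]
      have hn0 : (0 : ℝ) ≤ n := n.cast_nonneg
      have hn1 : (1 : ℝ) ≤ n := by exact_mod_cast hnpos
      have hsubn : Icc (n : ℝ) (n + 3) ⊆ Ici 1 := fun s hs => hn1.trans hs.1
      have hsubn0 : Icc (n : ℝ) (n + 3) ⊆ Ici 0 := hsubn.trans hsubI1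
      have hlin' := hlinW.mono hsubn (uniqueDiffOn_Icc (by linarith))
      have horbit' : ∀ s ∈ Icc (0 : ℝ) 3, F.S (F.modelMap ν xF U' s (F.modelMap ν xF U' n y)) = stateOf (u (n + s)) :=
        fun s hs => by rw [hsemi s n hs.1 hn0, horb (s + n) (by linarith [hs.1]), add_comm]
      have hnI : (n : ℝ) ∈ Ici (1 : ℝ) := hn1
      have hh : F.S (F.S (stateOf (W n) - stateOf (laplacian (W n)))) = stateOf (W n) :=
        stub_framePreimageTools F.ι F.b F.m F.hmodes F.S F.hS (hWs.isSmooth_slice hnI) (hWd _ hnI) (hWm _ hnI)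
      have key := F.fderiv_modelMap_eq_frame_of_classical hν xF hU hU' hUU' htube hcont (hyU n hn0) (a₀ := n)
        (hsol.smooth_velocity.mono hsubn0) (fun t ht => hud t (hsubn0 ht)) (fun t ht => hum t (hsubn0 ht)) hlin' horbit' hh
        1 ⟨zero_le_one, by norm_num⟩
      have key' : fderiv ℝ (F.modelMap ν xF U' 1) (F.modelMap ν xF U' n y) (F.S (stateOf (W n) - stateOf (laplacian (W n)))) =
          F.S (stateOf (W (n + 1)) - stateOf (laplacian (W (n + 1)))) := key
      rw [key', Nat.cast_succ]

/-! ## The flow direction -/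

/-- **The flow direction of the model at a core point is the frame of `∂ₜu(0)`.**  If the model orbit of `y` is conjugate to
the classical trajectory `u` (`F.S (g t y) = [u t]`, `t ≥ 0`), then `flowDir g y = F.S ([∂ₜu 0] − [Δ ∂ₜu 0])` with
`∂ₜu = Torus.timeDerivWithin (Icc 0 3) u` (A3a `stub_frameCurveDerivTools`: the frame curve is differentiable within `[0, 3]`
with derivative the frame of `∂ₜu`; `[0, 3]` is a neighbourhood of `0` within `[0, ∞)`, where one-sided derivatives are
unique). [folklore] -/
theorem flowDir_modelMap_eq {y : Hsp} {f : (UnitAddTorus (Fin 3)) → (EuclideanSpace ℝ (Fin 3))}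
    {u : ℝ → (UnitAddTorus (Fin 3)) → (EuclideanSpace ℝ (Fin 3))} {p : ℝ → (UnitAddTorus (Fin 3)) → ℝ}
    (hsol : IsClassicalNSSolutionOn (Ici 0) ν (fun _ => f) u p) (hum : ∀ t : ℝ, 0 ≤ t → HasZeroMean (u t))
    (horb : ∀ t : ℝ, 0 ≤ t → F.S (F.modelMap ν xF U' t y) = stateOf (u t)) :
    flowDir (F.modelMap ν xF U') y = F.S (stateOf (Torus.timeDerivWithin (Icc 0 3) u 0) -
      stateOf (laplacian (Torus.timeDerivWithin (Icc 0 3) u 0))) := by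
  -- the interface hypotheses of the section are not all needed here
  have _ := hU; have _ := hU'; have _ := hUU'; have _ := htube; have _ := hcont; have _ := hν
  have h3 : (0 : ℝ) < 3 := zero_lt_three
  have h03 : (0 : ℝ) < 0 + 3 := by norm_num
  have hsol3 : IsClassicalNSSolutionOn (Icc 0 (0 + 3)) ν (fun _ => f) u p :=
    hsol.mono (fun t ht => ht.1) (uniqueDiffOn_Icc h03)
  have hmean3 : ∀ t ∈ Icc (0 : ℝ) (0 + 3), HasZeroMean (u t) := fun t ht => hum t ht.1
  -- `∂ₜu` within `[0, 0 + 3]` is a classical linearised solution (A1): honest slices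
  have hA1 := stub_timeDerivLinearisedTools h03 hsol3 hmean3
  set w : ℝ → (UnitAddTorus (Fin 3)) → (EuclideanSpace ℝ (Fin 3)) := Torus.timeDerivWithin (Icc 0 (0 + 3)) u with hw
  obtain ⟨Y₁, hY₁def⟩ : ∃ Y₁ : ℝ → Hsp, Y₁ = fun t => F.S (stateOf (w (0 + t)) - stateOf (laplacian (w (0 + t)))) := ⟨_, rfl⟩
  have hI : ∀ t ∈ Icc (0 : ℝ) 3, 0 + t ∈ Icc (0 : ℝ) (0 + 3) := fun t ht => ⟨by linarith [ht.1], by linarith [ht.2]⟩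
  have hY : ∀ t ∈ Icc (0 : ℝ) 3, F.S (F.modelMap ν xF U' t y) = stateOf (u (0 + t)) := fun t ht => by
    rw [zero_add]; exact horb t ht.1
  have hY₁ : ∀ t ∈ Icc (0 : ℝ) 3, F.S (Y₁ t) = stateOf (w (0 + t)) := fun t ht => by
    rw [hY₁def]
    exact stub_framePreimageTools F.ι F.b F.m F.hmodes F.S F.hS (hA1.1.isSmooth_slice (hI t ht)) (hA1.2.2.1 _ (hI t ht))
      (hA1.2.2.2.1 _ (hI t ht))
  have hder := stub_frameCurveDerivTools F.ι F.b F.m F.hpos F.hmodes F.S F.hS h3 hsol3 hmean3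
    (fun t => F.modelMap ν xF U' t y) Y₁ hY hY₁ 0 (left_mem_Icc.2 h3.le)
  have hIci : HasDerivWithinAt (fun t => F.modelMap ν xF U' t y) (Y₁ 0) (Ici 0) 0 :=
    hder.mono_of_mem_nhdsWithin (Icc_mem_nhdsGE h3)
  unfold flowDir
  rw [hIci.derivWithin (uniqueDiffWithinAt_Ici 0), hY₁def]
  simp only [hw, add_zero, zero_add]

/-- **The image of the flow direction under `D(g 1)(y)` is the frame of `∂ₜu(1)`**: `∂ₜu` within `[0, 3]` is a classical
linearised solution along `u` (A1 `stub_timeDerivLinearisedTools`) whose frame at `0` is the flow direction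
(`flowDir_modelMap_eq`), so the closed KEY lemma applies. [folklore] -/
theorem fderiv_modelMap_one_flowDir {y : Hsp} (hy0 : y ∈ U) {f : (UnitAddTorus (Fin 3)) → (EuclideanSpace ℝ (Fin 3))}
    {u : ℝ → (UnitAddTorus (Fin 3)) → (EuclideanSpace ℝ (Fin 3))} {p : ℝ → (UnitAddTorus (Fin 3)) → ℝ}
    (hsol : IsClassicalNSSolutionOn (Ici 0) ν (fun _ => f) u p) (hum : ∀ t : ℝ, 0 ≤ t → HasZeroMean (u t))
    (horb : ∀ t : ℝ, 0 ≤ t → F.S (F.modelMap ν xF U' t y) = stateOf (u t)) :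
    fderiv ℝ (F.modelMap ν xF U' 1) y (flowDir (F.modelMap ν xF U') y) =
      F.S (stateOf (Torus.timeDerivWithin (Icc 0 3) u 1) - stateOf (laplacian (Torus.timeDerivWithin (Icc 0 3) u 1))) := by
  have h03 : (0 : ℝ) < 0 + 3 := by norm_num
  have hsub : Icc (0 : ℝ) (0 + 3) ⊆ Ici 0 := fun t ht => ht.1
  have hsol3 : IsClassicalNSSolutionOn (Icc 0 (0 + 3)) ν (fun _ => f) u p := hsol.mono hsub (uniqueDiffOn_Icc h03)
  have hmean3 : ∀ t ∈ Icc (0 : ℝ) (0 + 3), HasZeroMean (u t) := fun t ht => hum t ht.1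
  have hA1 := stub_timeDerivLinearisedTools h03 hsol3 hmean3
  have hX := flowDir_modelMap_eq F hν xF hU hU' hUU' htube hcont hsol hum horb
  have e3 : Icc (0 : ℝ) (0 + 3) = Icc 0 3 := by rw [zero_add]
  rw [e3] at hA1 hsol3 hmean3
  have hh : F.S (flowDir (F.modelMap ν xF U') y) = stateOf (Torus.timeDerivWithin (Icc 0 3) u 0) := by
    rw [hX]
    have h0 : (0 : ℝ) ∈ Icc (0 : ℝ) 3 := left_mem_Icc.2 zero_le_three
    exact stub_framePreimageTools F.ι F.b F.m F.hmodes F.S F.hS (hA1.1.isSmooth_slice h0) (hA1.2.2.1 0 h0) (hA1.2.2.2.1 0 h0)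
  have hlin' : IsLinearizedNSSolutionOn (Icc 0 (0 + 3)) ν u (Torus.timeDerivWithin (Icc 0 3) u)
      (Torus.timeDerivWithin (Icc 0 3) p) := by rw [e3]; exact hA1
  have key := F.fderiv_modelMap_eq_frame_of_classical hν xF hU hU' hUU' htube hcont hy0 (a₀ := 0)
    (by rw [e3]; exact hsol3.smooth_velocity) (by rw [e3]; exact hsol3.divFree) (by rw [e3]; exact hmean3) hlin'
    (fun s hs => by rw [zero_add]; exact horb s hs.1) (by rw [hh]) 1 ⟨zero_le_one, by norm_num⟩
  have key' : fderiv ℝ (F.modelMap ν xF U' 1) y (flowDir (F.modelMap ν xF U') y) =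
      F.S (stateOf (Torus.timeDerivWithin (Icc 0 3) u (0 + 1)) -
        stateOf (laplacian (Torus.timeDerivWithin (Icc 0 3) u (0 + 1)))) := key
  rw [key', zero_add]

end Cocycle

end Summit.AnomalousDissipation.AnomalousDissipation.Theorems.DenseLoudDesignerForces.Ergodic

end
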